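import Mathlib
import HarnessLib
import Literature.MathematicalPhysics.StatisticalMechanics.RenormalisationMapFreeHtKernelSecondDiffRaw
import Literature.MathematicalPhysics.StatisticalMechanics.RenormalisationMapFreeHtKernelWeak

/-!
# `‖nextK(μ_a) − nextK(μ_b) − nextK(μ_c) + nextK(μ_e)‖_{k+1}^{(A)} ≤ Θ₄` — four step kernels (kernel SECOND DIFFERENCE) at a
# COMMON FREE `H̃`, weak norm, kernel level ([ABKM19] Theorem 6.8 ⊗ Lemma 8.4 (ℓ = 2); block B4 of (12.53) at `ℓ = 2`)

The weak-norm conversion of the four-piece bound (`RenormalisationMapFreeHtKernelSecondDiffRaw`): the single-block family in block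
form (`2L^d e^{(L^d+1)/4}[…]·A·A^{−|U|_{k+1}}`, non-zero only when `U` is a single `(k+1)`-block, where the near-`U` pair constant is
`ℓ_n(U) ≤ ℓ̄·λ^{−1}`) and the three large kernel-only second-order twins with `κ^{|U|_k}·c^{|U|_{k+1}}·A^{−η|U|_{k+1}}` absorbed WITH
ROOM `λ` (counting conditions `hc3b/hc2b` at the per-block constant `max(A_𝒫, κ_p)`), so that the `U`-dependence of the near-`U`
second-order pair constant `ℓ_n(U)` is absorbed (`ℓ_n(U)·λ^{|U|_{k+1}} ≤ ℓ̄`) — the kernel-only half of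
`RenormalisationMapFreeHtKernelWeak` verbatim, with the block term replacing the block part / `Σ₁` / defect.  Every term carries `ℓ̄`:
`Θ₄` is LINEAR in the second-order pair constant, first order in `(‖H‖_{k,0}, C)`, and does not depend on `U` nor on `H̃` (beyond
`‖H̃‖_{k,0} ≤ τ`): this is the kernel-parallelogram bound (B4) of the stub `stub_f4l2ShrinkLoc`.

* `tayNormLE_nextK_freeHt_kernelSecondDiff_of_pieces` — the glue with four arbitrary piece constants;
* **`weakNormLE_nextK_freeHt_kernelSecondDiff_abkm_of_stepKernelBounds`**.

Everything is proved; no named fact.  Honest scope: rung route `Summits/HubbardSuperconductivity/…/Theses/ComplexGFFStiffness`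
(stiffness of a complex Gaussian gradient field via the [ABKM19] RG); nothing about superconductivity in the Hubbard model is claimed.

## References
* S. Adams, S. Buchholz, R. Kotecký, S. Müller, arXiv:1910.13564, Definition 6.5 (6.34), Theorem 6.8, Lemma 8.4, Ch. 12 (12.4),
  Lemma 12.6 (12.53) [AdamsBuchholzKoteckyMuller2019].
-/

noncomputable section

namespace Literature.MathematicalPhysics.StatisticalMechanics.GradientRG

open scoped BigOperators Classical
open Finset MeasureTheory
open Literature.MathematicalPhysics.StatisticalMechanics.TorusPolymer
  (IsPolymer blocks polys bprod blockOf thicken reblock mem_polys mem_blocks numBlocks isPolymer_blockOf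
    card_blocks_eq_numBlocks blocks_blockOf empty_mem_polys reblock_empty self_mem_polys)
open Literature.Barriers.CriticalPhenomena.LongRangePhi4.Polymer (IsConn components)
open Literature.MathematicalPhysics.QuantumFieldTheory

variable {d M : ℕ} [NeZero M]

set_option maxHeartbeats 1600000 in
/-- **Glue (four kernels, common free `H̃`).** The four piece bounds — single-block family, `Σ₂ᴸ`, `Σ₃`, `Σ₄` second differences
— with constants `c₁,…,c₄` give `‖ΔΔ nextK(U)‖ ≤ c₁ + c₂ + c₃ + c₄` (torus data, explicit `s = L^k`, `‖H‖_{k,0} ≤ 1/8`, admissible `K`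
with `K(∅) = 1`, `U ≠ ∅`). [cite: AdamsBuchholzKoteckyMuller2019, Definition 6.5 (6.34) / Theorem 6.8] -/
theorem tayNormLE_nextK_freeHt_kernelSecondDiff_of_pieces {L N Mord R n p r₀ : ℕ}
    {θbar lam μ δ₁ δ₀ A𝒫 A𝒫a A𝒫b A𝒫c A𝒫e C₂a C₂b C₂c C₂e h A : ℝ}
    {𝒞 : ℕ → (Fin d → ZMod M) → ℝ} (hd : 2 ≤ d) (hLodd : Odd L)
    (hM : M = L ^ N) {k : ℕ} (hkN : k + 1 ≤ N) (hp : d / 2 + 1 ≤ p) (hMord : d / 2 + 1 ≤ Mord)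
    (hB : AbkmWeightBounds L N Mord R n θbar lam μ δ₁ δ₀ A𝒫 𝒞
      (abkmWeightData L N Mord R θbar (schedDelta δ₀ δ₁ N) 𝒞))
    (hδ₀ : 0 < δ₀) (hδ₁ : 0 < δ₁) (hh : 0 < h) (hh0 : hZeroSq d R δ₀ δ₁ ≤ h ^ 2) (hA : 0 < A)
    {𝒞a 𝒞b 𝒞c 𝒞e : (Fin d → ZMod M) → ℝ}
    (hSa : StepKernelBounds (abkmWeightData L N Mord R θbar (schedDelta δ₀ δ₁ N) 𝒞) L k A𝒫a C₂a 𝒞a)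
    (hSb : StepKernelBounds (abkmWeightData L N Mord R θbar (schedDelta δ₀ δ₁ N) 𝒞) L k A𝒫b C₂b 𝒞b)
    (hSc : StepKernelBounds (abkmWeightData L N Mord R θbar (schedDelta δ₀ δ₁ N) 𝒞) L k A𝒫c C₂c 𝒞c)
    (hSe : StepKernelBounds (abkmWeightData L N Mord R θbar (schedDelta δ₀ δ₁ N) 𝒞) L k A𝒫e C₂e 𝒞e)
    {H : RelevantHamiltonian ℂ d}
    (hH : hamNorm (fieldWt h (L : ℝ) d k) ((L : ℝ) ^ k) (L ^ (d * k)) H ≤ 1 / 8)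
    (Ht : RelevantHamiltonian ℂ d)
    {K : Finset (Fin d → ZMod M) → ((Fin d → ZMod M) → ℝ) → ℂ} {C : ℝ} (hC : 0 ≤ C)
    (hK : WeakNormLE (abkmNormParams L N Mord R p r₀ h θbar A (schedDelta δ₀ δ₁ N) 𝒞) k K C)
    (hKfac : Factorises (L ^ k) K) (hK0 : ∀ φ, K ∅ φ = 1) (hKd : ∀ Y, ContDiff ℝ r₀ (K Y))
    (hKloc : ∀ Y, IsPolymer (L ^ k) Y → IsConn Y →
      IsGaugeLocal ((abkmNormParams L N Mord R p r₀ h θbar A (schedDelta δ₀ δ₁ N) 𝒞).gauge k Y) (K Y))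
    {U : Finset (Fin d → ZMod M)} (hUne : U.Nonempty)
    {c₁ c₂ c₃ c₄ : ℝ}
    (h1 : TayNormLE ((abkmNormParams L N Mord R p r₀ h θbar A (schedDelta δ₀ δ₁ N) 𝒞).gauge (k + 1) U) r₀
      ((abkmWeightData L N Mord R θbar (schedDelta δ₀ δ₁ N) 𝒞).weight (k + 1) U)
      (fun φ => ∑ X ∈ (blocks (L ^ k) univ).filter (fun B => TorusPolymer.closure (L * L ^ k) B = U),
        ∑ X₁ ∈ ({∅, X} : Finset (Finset (Fin d → ZMod M))),
        (bprod (L ^ k) (fun B => expNegH Ht B φ) (U \ X) * bprod (L ^ k) (fun B => expNegH (-Ht) B φ) (X \ U) *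
            (bprod (L ^ k) (fun B => 1 - expNegH Ht B φ) X₁ * fluct 𝒞a (polyP2 (L ^ k) H K (X \ X₁)) φ) -
          bprod (L ^ k) (fun B => expNegH Ht B φ) (U \ X) * bprod (L ^ k) (fun B => expNegH (-Ht) B φ) (X \ U) *
            (bprod (L ^ k) (fun B => 1 - expNegH Ht B φ) X₁ * fluct 𝒞b (polyP2 (L ^ k) H K (X \ X₁)) φ) -
          bprod (L ^ k) (fun B => expNegH Ht B φ) (U \ X) * bprod (L ^ k) (fun B => expNegH (-Ht) B φ) (X \ U) *
            (bprod (L ^ k) (fun B => 1 - expNegH Ht B φ) X₁ * fluct 𝒞c (polyP2 (L ^ k) H K (X \ X₁)) φ) +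
          bprod (L ^ k) (fun B => expNegH Ht B φ) (U \ X) * bprod (L ^ k) (fun B => expNegH (-Ht) B φ) (X \ U) *
            (bprod (L ^ k) (fun B => 1 - expNegH Ht B φ) X₁ * fluct 𝒞e (polyP2 (L ^ k) H K (X \ X₁)) φ))) c₁)
    (h2 : TayNormLE ((abkmNormParams L N Mord R p r₀ h θbar A (schedDelta δ₀ δ₁ N) 𝒞).gauge (k + 1) U) r₀
      ((abkmWeightData L N Mord R θbar (schedDelta δ₀ δ₁ N) 𝒞).weight (k + 1) U)
      (fun φ => ∑ X ∈ largePartIndex (L ^ k) L U,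
        (bprod (L ^ k) (fun B => expNegH Ht B φ) (U \ X) * bprod (L ^ k) (fun B => expNegH (-Ht) B φ) (X \ U) *
            (fluct 𝒞a (polyP2 (L ^ k) H K X) φ + bprod (L ^ k) (fun B => 1 - expNegH Ht B φ) X) -
          bprod (L ^ k) (fun B => expNegH Ht B φ) (U \ X) * bprod (L ^ k) (fun B => expNegH (-Ht) B φ) (X \ U) *
            (fluct 𝒞b (polyP2 (L ^ k) H K X) φ + bprod (L ^ k) (fun B => 1 - expNegH Ht B φ) X) -
          bprod (L ^ k) (fun B => expNegH Ht B φ) (U \ X) * bprod (L ^ k) (fun B => expNegH (-Ht) B φ) (X \ U) *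
            (fluct 𝒞c (polyP2 (L ^ k) H K X) φ + bprod (L ^ k) (fun B => 1 - expNegH Ht B φ) X) +
          bprod (L ^ k) (fun B => expNegH Ht B φ) (U \ X) * bprod (L ^ k) (fun B => expNegH (-Ht) B φ) (X \ U) *
            (fluct 𝒞e (polyP2 (L ^ k) H K X) φ + bprod (L ^ k) (fun B => 1 - expNegH Ht B φ) X))) c₂)
    (h3 : TayNormLE ((abkmNormParams L N Mord R p r₀ h θbar A (schedDelta δ₀ δ₁ N) 𝒞).gauge (k + 1) U) r₀
      ((abkmWeightData L N Mord R θbar (schedDelta δ₀ δ₁ N) 𝒞).weight (k + 1) U)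
      (fun φ => ∑ X ∈ ((polys (L ^ k) univ).filter (fun X => reblock (L ^ k) (L * L ^ k) X = U)).filter
          (fun X => ¬ IsConn X),
        (bprod (L ^ k) (fun B => expNegH Ht B φ) (U \ X) * bprod (L ^ k) (fun B => expNegH (-Ht) B φ) (X \ U) *
            (fluct 𝒞a (polyP2 (L ^ k) H K X) φ + bprod (L ^ k) (fun B => 1 - expNegH Ht B φ) X) -
          bprod (L ^ k) (fun B => expNegH Ht B φ) (U \ X) * bprod (L ^ k) (fun B => expNegH (-Ht) B φ) (X \ U) *
            (fluct 𝒞b (polyP2 (L ^ k) H K X) φ + bprod (L ^ k) (fun B => 1 - expNegH Ht B φ) X) -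
          bprod (L ^ k) (fun B => expNegH Ht B φ) (U \ X) * bprod (L ^ k) (fun B => expNegH (-Ht) B φ) (X \ U) *
            (fluct 𝒞c (polyP2 (L ^ k) H K X) φ + bprod (L ^ k) (fun B => 1 - expNegH Ht B φ) X) +
          bprod (L ^ k) (fun B => expNegH Ht B φ) (U \ X) * bprod (L ^ k) (fun B => expNegH (-Ht) B φ) (X \ U) *
            (fluct 𝒞e (polyP2 (L ^ k) H K X) φ + bprod (L ^ k) (fun B => 1 - expNegH Ht B φ) X))) c₃)
    (h4 : TayNormLE ((abkmNormParams L N Mord R p r₀ h θbar A (schedDelta δ₀ δ₁ N) 𝒞).gauge (k + 1) U) r₀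
      ((abkmWeightData L N Mord R θbar (schedDelta δ₀ δ₁ N) 𝒞).weight (k + 1) U)
      (fun φ => ∑ X ∈ (polys (L ^ k) univ).filter (fun X => reblock (L ^ k) (L * L ^ k) X = U),
        ∑ X₁ ∈ ((polys (L ^ k) X).erase X).erase ∅,
        (bprod (L ^ k) (fun B => expNegH Ht B φ) (U \ X) * bprod (L ^ k) (fun B => expNegH (-Ht) B φ) (X \ U) *
            (bprod (L ^ k) (fun B => 1 - expNegH Ht B φ) X₁ * fluct 𝒞a (polyP2 (L ^ k) H K (X \ X₁)) φ) -
          bprod (L ^ k) (fun B => expNegH Ht B φ) (U \ X) * bprod (L ^ k) (fun B => expNegH (-Ht) B φ) (X \ U) *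
            (bprod (L ^ k) (fun B => 1 - expNegH Ht B φ) X₁ * fluct 𝒞b (polyP2 (L ^ k) H K (X \ X₁)) φ) -
          bprod (L ^ k) (fun B => expNegH Ht B φ) (U \ X) * bprod (L ^ k) (fun B => expNegH (-Ht) B φ) (X \ U) *
            (bprod (L ^ k) (fun B => 1 - expNegH Ht B φ) X₁ * fluct 𝒞c (polyP2 (L ^ k) H K (X \ X₁)) φ) +
          bprod (L ^ k) (fun B => expNegH Ht B φ) (U \ X) * bprod (L ^ k) (fun B => expNegH (-Ht) B φ) (X \ U) *
            (bprod (L ^ k) (fun B => 1 - expNegH Ht B φ) X₁ * fluct 𝒞e (polyP2 (L ^ k) H K (X \ X₁)) φ))) c₄) :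
    TayNormLE ((abkmNormParams L N Mord R p r₀ h θbar A (schedDelta δ₀ δ₁ N) 𝒞).gauge (k + 1) U) r₀
      ((abkmWeightData L N Mord R θbar (schedDelta δ₀ δ₁ N) 𝒞).weight (k + 1) U)
      (fun φ => nextK (L ^ k) (reblock (L ^ k) (L * L ^ k)) (stepMeasure 𝒞a) (expNegH H) (expNegH Ht) K U φ -
        nextK (L ^ k) (reblock (L ^ k) (L * L ^ k)) (stepMeasure 𝒞b) (expNegH H) (expNegH Ht) K U φ -
        nextK (L ^ k) (reblock (L ^ k) (L * L ^ k)) (stepMeasure 𝒞c) (expNegH H) (expNegH Ht) K U φ +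
        nextK (L ^ k) (reblock (L ^ k) (L * L ^ k)) (stepMeasure 𝒞e) (expNegH H) (expNegH Ht) K U φ)
      (c₁ + c₂ + c₃ + c₄) := by
  set P := abkmNormParams L N Mord R p r₀ h θbar A (schedDelta δ₀ δ₁ N) 𝒞 with hP
  set W := abkmWeightData L N Mord R θbar (schedDelta δ₀ δ₁ N) 𝒞 with hW
  set T := (polys (L ^ k) univ).filter (fun X => reblock (L ^ k) (L * L ^ k) X = U) with hT
  set T₁ := (blocks (L ^ k) univ).filter (fun B => TorusPolymer.closure (L * L ^ k) B = U) with hT₁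
  have hMo : Odd M := by rw [hM]; exact hLodd.pow
  have hsodd : Odd (L ^ k) := hLodd.pow
  have hTp : ∀ X ∈ T, IsPolymer (L ^ k) X := fun X hX => (mem_polys.1 (mem_filter.1 hX).1).2
  have hT₁T : T₁ ⊆ T := by
    have e : blockPartIndex (⟨L ^ k, L, 𝒞a, 0, ∅⟩ : StepData d M) U = T₁ := rfl
    rw [← e, ← filter_reblock_isConn_card_eq_one (⟨L ^ k, L, 𝒞a, 0, ∅⟩ : StepData d M) hMo hsodd hLodd U]
    exact filter_subset _ _
  have hT₂T : largePartIndex (L ^ k) L U ⊆ T := by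
    intro X hX
    obtain ⟨hXp, -, -, hXU⟩ := mem_largePartIndex.1 hX
    exact mem_filter.2 ⟨mem_polys.2 ⟨subset_univ _, hXp⟩, hXU⟩
  have hT₃T : T.filter (fun X => ¬ IsConn X) ⊆ T := filter_subset _ _
  have hpairp : ∀ X ∈ T, ∀ X₁ ∈ ({∅, X} : Finset (Finset (Fin d → ZMod M))), X₁ ∈ polys (L ^ k) X := by
    intro X hX X₁ hX₁
    rcases mem_insert.1 hX₁ with rfl | h1
    · exact empty_mem_polys _ _
    · rw [mem_singleton.1 h1]; exact self_mem_polys (hTp X hX)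
  have heep : ∀ X ∈ T, ∀ X₁ ∈ ((polys (L ^ k) X).erase X).erase ∅, X₁ ∈ polys (L ^ k) X :=
    fun X _ X₁ hX₁ => mem_of_mem_erase (mem_of_mem_erase hX₁)
  -- smoothness of the summands
  have hsubd : ∀ {𝒞q : (Fin d → ZMod M) → ℝ} {A𝒫q C₂q : ℝ},
      StepKernelBounds W L k A𝒫q C₂q 𝒞q → ∀ X ∈ T, ∀ X₁ ∈ polys (L ^ k) X,
      ContDiff ℝ r₀ (fun φ : (Fin d → ZMod M) → ℝ =>
        bprod (L ^ k) (fun B => expNegH Ht B φ) (U \ X) * bprod (L ^ k) (fun B => expNegH (-Ht) B φ) (X \ U) *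
            (bprod (L ^ k) (fun B => 1 - expNegH Ht B φ) X₁ * fluct 𝒞q (polyP2 (L ^ k) H K (X \ X₁)) φ)) :=
    fun hSq X hX X₁ hX₁ => contDiff_reblockSub_abkm_of_stepKernelBounds hd hLodd hM hkN hSq hp hMord hB hδ₀ hδ₁ hh hh0 hA
      (hTp X hX) hX₁ Ht hH hC hK hKfac hK0 hKd hKloc U
  have htopd : ∀ {𝒞q : (Fin d → ZMod M) → ℝ} {A𝒫q C₂q : ℝ},
      StepKernelBounds W L k A𝒫q C₂q 𝒞q → ∀ X ∈ T,
      ContDiff ℝ r₀ (fun φ : (Fin d → ZMod M) → ℝ =>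
        bprod (L ^ k) (fun B => expNegH Ht B φ) (U \ X) * bprod (L ^ k) (fun B => expNegH (-Ht) B φ) (X \ U) *
            (fluct 𝒞q (polyP2 (L ^ k) H K X) φ + bprod (L ^ k) (fun B => 1 - expNegH Ht B φ) X)) :=
    fun hSq X hX => contDiff_reblockTop_abkm_of_stepKernelBounds hd hLodd hM hkN hSq hp hMord hB hδ₀ hδ₁ hh hh0 hA
      (hTp X hX) Ht hH hC hK hKfac hK0 hKd hKloc U
  have hF1d : ContDiff ℝ r₀ (fun φ => ∑ X ∈ (blocks (L ^ k) univ).filter (fun B => TorusPolymer.closure (L * L ^ k) B = U),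
        ∑ X₁ ∈ ({∅, X} : Finset (Finset (Fin d → ZMod M))),
        (bprod (L ^ k) (fun B => expNegH Ht B φ) (U \ X) * bprod (L ^ k) (fun B => expNegH (-Ht) B φ) (X \ U) *
            (bprod (L ^ k) (fun B => 1 - expNegH Ht B φ) X₁ * fluct 𝒞a (polyP2 (L ^ k) H K (X \ X₁)) φ) -
          bprod (L ^ k) (fun B => expNegH Ht B φ) (U \ X) * bprod (L ^ k) (fun B => expNegH (-Ht) B φ) (X \ U) *
            (bprod (L ^ k) (fun B => 1 - expNegH Ht B φ) X₁ * fluct 𝒞b (polyP2 (L ^ k) H K (X \ X₁)) φ) -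
          bprod (L ^ k) (fun B => expNegH Ht B φ) (U \ X) * bprod (L ^ k) (fun B => expNegH (-Ht) B φ) (X \ U) *
            (bprod (L ^ k) (fun B => 1 - expNegH Ht B φ) X₁ * fluct 𝒞c (polyP2 (L ^ k) H K (X \ X₁)) φ) +
          bprod (L ^ k) (fun B => expNegH Ht B φ) (U \ X) * bprod (L ^ k) (fun B => expNegH (-Ht) B φ) (X \ U) *
            (bprod (L ^ k) (fun B => 1 - expNegH Ht B φ) X₁ * fluct 𝒞e (polyP2 (L ^ k) H K (X \ X₁)) φ))) := by
    refine ContDiff.sum fun X hX => ContDiff.sum fun X₁ hX₁ => ?_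
    have hXT := hT₁T hX
    have hX₁p := hpairp X hXT X₁ hX₁
    exact (((hsubd hSa X hXT X₁ hX₁p).sub (hsubd hSb X hXT X₁ hX₁p)).sub (hsubd hSc X hXT X₁ hX₁p)).add
      (hsubd hSe X hXT X₁ hX₁p)
  have hF2d : ContDiff ℝ r₀ (fun φ => ∑ X ∈ largePartIndex (L ^ k) L U,
        (bprod (L ^ k) (fun B => expNegH Ht B φ) (U \ X) * bprod (L ^ k) (fun B => expNegH (-Ht) B φ) (X \ U) *
            (fluct 𝒞a (polyP2 (L ^ k) H K X) φ + bprod (L ^ k) (fun B => 1 - expNegH Ht B φ) X) -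
          bprod (L ^ k) (fun B => expNegH Ht B φ) (U \ X) * bprod (L ^ k) (fun B => expNegH (-Ht) B φ) (X \ U) *
            (fluct 𝒞b (polyP2 (L ^ k) H K X) φ + bprod (L ^ k) (fun B => 1 - expNegH Ht B φ) X) -
          bprod (L ^ k) (fun B => expNegH Ht B φ) (U \ X) * bprod (L ^ k) (fun B => expNegH (-Ht) B φ) (X \ U) *
            (fluct 𝒞c (polyP2 (L ^ k) H K X) φ + bprod (L ^ k) (fun B => 1 - expNegH Ht B φ) X) +
          bprod (L ^ k) (fun B => expNegH Ht B φ) (U \ X) * bprod (L ^ k) (fun B => expNegH (-Ht) B φ) (X \ U) *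
            (fluct 𝒞e (polyP2 (L ^ k) H K X) φ + bprod (L ^ k) (fun B => 1 - expNegH Ht B φ) X))) := by
    refine ContDiff.sum fun X hX => ?_
    have hXT := hT₂T hX
    exact (((htopd hSa X hXT).sub (htopd hSb X hXT)).sub (htopd hSc X hXT)).add (htopd hSe X hXT)
  have hF3d : ContDiff ℝ r₀ (fun φ => ∑ X ∈ ((polys (L ^ k) univ).filter (fun X => reblock (L ^ k) (L * L ^ k) X = U)).filter
          (fun X => ¬ IsConn X),
        (bprod (L ^ k) (fun B => expNegH Ht B φ) (U \ X) * bprod (L ^ k) (fun B => expNegH (-Ht) B φ) (X \ U) *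
            (fluct 𝒞a (polyP2 (L ^ k) H K X) φ + bprod (L ^ k) (fun B => 1 - expNegH Ht B φ) X) -
          bprod (L ^ k) (fun B => expNegH Ht B φ) (U \ X) * bprod (L ^ k) (fun B => expNegH (-Ht) B φ) (X \ U) *
            (fluct 𝒞b (polyP2 (L ^ k) H K X) φ + bprod (L ^ k) (fun B => 1 - expNegH Ht B φ) X) -
          bprod (L ^ k) (fun B => expNegH Ht B φ) (U \ X) * bprod (L ^ k) (fun B => expNegH (-Ht) B φ) (X \ U) *
            (fluct 𝒞c (polyP2 (L ^ k) H K X) φ + bprod (L ^ k) (fun B => 1 - expNegH Ht B φ) X) +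
          bprod (L ^ k) (fun B => expNegH Ht B φ) (U \ X) * bprod (L ^ k) (fun B => expNegH (-Ht) B φ) (X \ U) *
            (fluct 𝒞e (polyP2 (L ^ k) H K X) φ + bprod (L ^ k) (fun B => 1 - expNegH Ht B φ) X))) := by
    refine ContDiff.sum fun X hX => ?_
    have hXT := hT₃T hX
    exact (((htopd hSa X hXT).sub (htopd hSb X hXT)).sub (htopd hSc X hXT)).add (htopd hSe X hXT)
  have hF4d : ContDiff ℝ r₀ (fun φ => ∑ X ∈ (polys (L ^ k) univ).filter (fun X => reblock (L ^ k) (L * L ^ k) X = U),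
        ∑ X₁ ∈ ((polys (L ^ k) X).erase X).erase ∅,
        (bprod (L ^ k) (fun B => expNegH Ht B φ) (U \ X) * bprod (L ^ k) (fun B => expNegH (-Ht) B φ) (X \ U) *
            (bprod (L ^ k) (fun B => 1 - expNegH Ht B φ) X₁ * fluct 𝒞a (polyP2 (L ^ k) H K (X \ X₁)) φ) -
          bprod (L ^ k) (fun B => expNegH Ht B φ) (U \ X) * bprod (L ^ k) (fun B => expNegH (-Ht) B φ) (X \ U) *
            (bprod (L ^ k) (fun B => 1 - expNegH Ht B φ) X₁ * fluct 𝒞b (polyP2 (L ^ k) H K (X \ X₁)) φ) -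
          bprod (L ^ k) (fun B => expNegH Ht B φ) (U \ X) * bprod (L ^ k) (fun B => expNegH (-Ht) B φ) (X \ U) *
            (bprod (L ^ k) (fun B => 1 - expNegH Ht B φ) X₁ * fluct 𝒞c (polyP2 (L ^ k) H K (X \ X₁)) φ) +
          bprod (L ^ k) (fun B => expNegH Ht B φ) (U \ X) * bprod (L ^ k) (fun B => expNegH (-Ht) B φ) (X \ U) *
            (bprod (L ^ k) (fun B => 1 - expNegH Ht B φ) X₁ * fluct 𝒞e (polyP2 (L ^ k) H K (X \ X₁)) φ))) := by
    refine ContDiff.sum fun X hX => ContDiff.sum fun X₁ hX₁ => ?_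
    have hX₁p := heep X hX X₁ hX₁
    exact (((hsubd hSa X hX X₁ hX₁p).sub (hsubd hSb X hX X₁ hX₁p)).sub (hsubd hSc X hX X₁ hX₁p)).add
      (hsubd hSe X hX X₁ hX₁p)
  -- the four-family decomposition for each kernel
  have hdec : ∀ {𝒞q : (Fin d → ZMod M) → ℝ} {A𝒫q C₂q : ℝ},
      StepKernelBounds W L k A𝒫q C₂q 𝒞q → ∀ φ : (Fin d → ZMod M) → ℝ,
      nextK (L ^ k) (reblock (L ^ k) (L * L ^ k)) (stepMeasure 𝒞q) (expNegH H) (expNegH Ht) K U φ =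
      (∑ X ∈ T₁, ∑ X₁ ∈ ({∅, X} : Finset (Finset (Fin d → ZMod M))),
          bprod (L ^ k) (fun B => expNegH Ht B φ) (U \ X) * bprod (L ^ k) (fun B => expNegH (-Ht) B φ) (X \ U) *
            (bprod (L ^ k) (fun B => 1 - expNegH Ht B φ) X₁ * fluct 𝒞q (polyP2 (L ^ k) H K (X \ X₁)) φ)) +
      (∑ X ∈ largePartIndex (L ^ k) L U,
        bprod (L ^ k) (fun B => expNegH Ht B φ) (U \ X) * bprod (L ^ k) (fun B => expNegH (-Ht) B φ) (X \ U) *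
          (fluct 𝒞q (polyP2 (L ^ k) H K X) φ + bprod (L ^ k) (fun B => 1 - expNegH Ht B φ) X)) +
      (∑ X ∈ T.filter (fun X => ¬ IsConn X),
        bprod (L ^ k) (fun B => expNegH Ht B φ) (U \ X) * bprod (L ^ k) (fun B => expNegH (-Ht) B φ) (X \ U) *
          (fluct 𝒞q (polyP2 (L ^ k) H K X) φ + bprod (L ^ k) (fun B => 1 - expNegH Ht B φ) X)) +
      ∑ X ∈ T, ∑ X₁ ∈ ((polys (L ^ k) X).erase X).erase ∅,
          bprod (L ^ k) (fun B => expNegH Ht B φ) (U \ X) * bprod (L ^ k) (fun B => expNegH (-Ht) B φ) (X \ U) *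
            (bprod (L ^ k) (fun B => 1 - expNegH Ht B φ) X₁ * fluct 𝒞q (polyP2 (L ^ k) H K (X \ X₁)) φ) := by
    intro 𝒞q A𝒫q C₂q hSq φ
    have e := nextK_freeHt_eq_four_abkm_of_stepKernelBounds (n := n) (lam := lam) (μ := μ) (p := p) (r₀ := r₀) (A := A) hd hLodd
      hM hkN hp hMord hB hδ₀ hδ₁ hh hh0 hA (⟨L ^ k, L, 𝒞q, 0, ∅⟩ : StepData d M) rfl rfl hSq hH Ht hC hK hKfac hK0 hKd hKloc
      hUne φ
    simp only at e
    exact e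
  have hfun : (fun φ => nextK (L ^ k) (reblock (L ^ k) (L * L ^ k)) (stepMeasure 𝒞a) (expNegH H) (expNegH Ht) K U φ -
        nextK (L ^ k) (reblock (L ^ k) (L * L ^ k)) (stepMeasure 𝒞b) (expNegH H) (expNegH Ht) K U φ -
        nextK (L ^ k) (reblock (L ^ k) (L * L ^ k)) (stepMeasure 𝒞c) (expNegH H) (expNegH Ht) K U φ +
        nextK (L ^ k) (reblock (L ^ k) (L * L ^ k)) (stepMeasure 𝒞e) (expNegH H) (expNegH Ht) K U φ) =
      (((fun φ => ∑ X ∈ (blocks (L ^ k) univ).filter (fun B => TorusPolymer.closure (L * L ^ k) B = U),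
        ∑ X₁ ∈ ({∅, X} : Finset (Finset (Fin d → ZMod M))),
        (bprod (L ^ k) (fun B => expNegH Ht B φ) (U \ X) * bprod (L ^ k) (fun B => expNegH (-Ht) B φ) (X \ U) *
            (bprod (L ^ k) (fun B => 1 - expNegH Ht B φ) X₁ * fluct 𝒞a (polyP2 (L ^ k) H K (X \ X₁)) φ) -
          bprod (L ^ k) (fun B => expNegH Ht B φ) (U \ X) * bprod (L ^ k) (fun B => expNegH (-Ht) B φ) (X \ U) *
            (bprod (L ^ k) (fun B => 1 - expNegH Ht B φ) X₁ * fluct 𝒞b (polyP2 (L ^ k) H K (X \ X₁)) φ) -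
          bprod (L ^ k) (fun B => expNegH Ht B φ) (U \ X) * bprod (L ^ k) (fun B => expNegH (-Ht) B φ) (X \ U) *
            (bprod (L ^ k) (fun B => 1 - expNegH Ht B φ) X₁ * fluct 𝒞c (polyP2 (L ^ k) H K (X \ X₁)) φ) +
          bprod (L ^ k) (fun B => expNegH Ht B φ) (U \ X) * bprod (L ^ k) (fun B => expNegH (-Ht) B φ) (X \ U) *
            (bprod (L ^ k) (fun B => 1 - expNegH Ht B φ) X₁ * fluct 𝒞e (polyP2 (L ^ k) H K (X \ X₁)) φ))) + (fun φ => ∑ X ∈ largePartIndex (L ^ k) L U,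
        (bprod (L ^ k) (fun B => expNegH Ht B φ) (U \ X) * bprod (L ^ k) (fun B => expNegH (-Ht) B φ) (X \ U) *
            (fluct 𝒞a (polyP2 (L ^ k) H K X) φ + bprod (L ^ k) (fun B => 1 - expNegH Ht B φ) X) -
          bprod (L ^ k) (fun B => expNegH Ht B φ) (U \ X) * bprod (L ^ k) (fun B => expNegH (-Ht) B φ) (X \ U) *
            (fluct 𝒞b (polyP2 (L ^ k) H K X) φ + bprod (L ^ k) (fun B => 1 - expNegH Ht B φ) X) -
          bprod (L ^ k) (fun B => expNegH Ht B φ) (U \ X) * bprod (L ^ k) (fun B => expNegH (-Ht) B φ) (X \ U) *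
            (fluct 𝒞c (polyP2 (L ^ k) H K X) φ + bprod (L ^ k) (fun B => 1 - expNegH Ht B φ) X) +
          bprod (L ^ k) (fun B => expNegH Ht B φ) (U \ X) * bprod (L ^ k) (fun B => expNegH (-Ht) B φ) (X \ U) *
            (fluct 𝒞e (polyP2 (L ^ k) H K X) φ + bprod (L ^ k) (fun B => 1 - expNegH Ht B φ) X)))) + (fun φ => ∑ X ∈ ((polys (L ^ k) univ).filter (fun X => reblock (L ^ k) (L * L ^ k) X = U)).filter
          (fun X => ¬ IsConn X),
        (bprod (L ^ k) (fun B => expNegH Ht B φ) (U \ X) * bprod (L ^ k) (fun B => expNegH (-Ht) B φ) (X \ U) *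
            (fluct 𝒞a (polyP2 (L ^ k) H K X) φ + bprod (L ^ k) (fun B => 1 - expNegH Ht B φ) X) -
          bprod (L ^ k) (fun B => expNegH Ht B φ) (U \ X) * bprod (L ^ k) (fun B => expNegH (-Ht) B φ) (X \ U) *
            (fluct 𝒞b (polyP2 (L ^ k) H K X) φ + bprod (L ^ k) (fun B => 1 - expNegH Ht B φ) X) -
          bprod (L ^ k) (fun B => expNegH Ht B φ) (U \ X) * bprod (L ^ k) (fun B => expNegH (-Ht) B φ) (X \ U) *
            (fluct 𝒞c (polyP2 (L ^ k) H K X) φ + bprod (L ^ k) (fun B => 1 - expNegH Ht B φ) X) +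
          bprod (L ^ k) (fun B => expNegH Ht B φ) (U \ X) * bprod (L ^ k) (fun B => expNegH (-Ht) B φ) (X \ U) *
            (fluct 𝒞e (polyP2 (L ^ k) H K X) φ + bprod (L ^ k) (fun B => 1 - expNegH Ht B φ) X)))) + (fun φ => ∑ X ∈ (polys (L ^ k) univ).filter (fun X => reblock (L ^ k) (L * L ^ k) X = U),
        ∑ X₁ ∈ ((polys (L ^ k) X).erase X).erase ∅,
        (bprod (L ^ k) (fun B => expNegH Ht B φ) (U \ X) * bprod (L ^ k) (fun B => expNegH (-Ht) B φ) (X \ U) *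
            (bprod (L ^ k) (fun B => 1 - expNegH Ht B φ) X₁ * fluct 𝒞a (polyP2 (L ^ k) H K (X \ X₁)) φ) -
          bprod (L ^ k) (fun B => expNegH Ht B φ) (U \ X) * bprod (L ^ k) (fun B => expNegH (-Ht) B φ) (X \ U) *
            (bprod (L ^ k) (fun B => 1 - expNegH Ht B φ) X₁ * fluct 𝒞b (polyP2 (L ^ k) H K (X \ X₁)) φ) -
          bprod (L ^ k) (fun B => expNegH Ht B φ) (U \ X) * bprod (L ^ k) (fun B => expNegH (-Ht) B φ) (X \ U) *
            (bprod (L ^ k) (fun B => 1 - expNegH Ht B φ) X₁ * fluct 𝒞c (polyP2 (L ^ k) H K (X \ X₁)) φ) +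
          bprod (L ^ k) (fun B => expNegH Ht B φ) (U \ X) * bprod (L ^ k) (fun B => expNegH (-Ht) B φ) (X \ U) *
            (bprod (L ^ k) (fun B => 1 - expNegH Ht B φ) X₁ * fluct 𝒞e (polyP2 (L ^ k) H K (X \ X₁)) φ))) := by
    funext φ
    simp only [Pi.add_apply]
    rw [hdec hSa φ, hdec hSb φ, hdec hSc φ, hdec hSe φ]
    simp only [sum_add_distrib, sum_sub_distrib]
    ring
  rw [hfun]
  exact ((h1.add h2 hF1d hF2d).add h3 (hF1d.add hF2d) hF3d).add h4 ((hF1d.add hF2d).add hF3d) hF4d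

set_option maxHeartbeats 1600000 in
/-- **`‖nextK(μ_a) − nextK(μ_b) − nextK(μ_c) + nextK(μ_e)‖_{k+1}^{(A)} ≤ Θ₄` at a common free `H̃`** (module docstring): torus data,
four step kernels with `StepKernelBounds`, the second-order pair property near every connected `U` with `U`-dependent constant
`ℓ_n(U)` absorbed by the room `λ ∈ (0, 1]` (`ℓ_n(U)·λ^{|U|_{k+1}} ≤ ℓ̄`), the counting conditions `hc3b/hc2b` with room; `‖H‖_{k,0} ≤ b ≤ 1/64`,
`‖K‖_k ≤ C`, `‖H̃‖_{k,0} ≤ τ ≤ 1/16`, letters `8e^{1/4}τ ≤ ω`, `16e^{1/4}b ≤ ω`, `2C ≤ ω`, `ωA² ≤ 1`, `κ ≥ 1 + e^{1/4}`, `A ≥ 1`.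
[cite: AdamsBuchholzKoteckyMuller2019, Theorem 6.8 / Lemma 8.4 / Ch. 12 (12.4) / Lemma 12.6 (12.53)] -/
theorem weakNormLE_nextK_freeHt_kernelSecondDiff_abkm_of_stepKernelBounds {L N Mord R n p r₀ : ℕ}
    {θbar lam μ δ₁ δ₀ A𝒫 A𝒫a A𝒫b A𝒫c A𝒫e C₂a C₂b C₂c C₂e h A : ℝ}
    {𝒞 : ℕ → (Fin d → ZMod M) → ℝ} (hd : 3 ≤ d) (hLodd : Odd L) (hL : 2 ^ (d + 3) + 16 * R ≤ L)
    (hR2 : 2 ≤ R) (hM : M = L ^ N) {k : ℕ} (hkN : k + 1 ≤ N)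
    (hp : d / 2 + 1 ≤ p) (hMord : d / 2 + 1 ≤ Mord)
    (hB : AbkmWeightBounds L N Mord R n θbar lam μ δ₁ δ₀ A𝒫 𝒞
      (abkmWeightData L N Mord R θbar (schedDelta δ₀ δ₁ N) 𝒞))
    (hδ₀ : 0 < δ₀) (hδ₁ : 0 < δ₁) (hh : 0 < h) (hh0 : hZeroSq d R δ₀ δ₁ ≤ h ^ 2) (hA𝒫a : 0 ≤ A𝒫a) (hA1 : 1 ≤ A)
    {𝒞a 𝒞b 𝒞c 𝒞e : (Fin d → ZMod M) → ℝ}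
    (hSa : StepKernelBounds (abkmWeightData L N Mord R θbar (schedDelta δ₀ δ₁ N) 𝒞) L k A𝒫a C₂a 𝒞a)
    (hSb : StepKernelBounds (abkmWeightData L N Mord R θbar (schedDelta δ₀ δ₁ N) 𝒞) L k A𝒫b C₂b 𝒞b)
    (hSc : StepKernelBounds (abkmWeightData L N Mord R θbar (schedDelta δ₀ δ₁ N) 𝒞) L k A𝒫c C₂c 𝒞c)
    (hSe : StepKernelBounds (abkmWeightData L N Mord R θbar (schedDelta δ₀ δ₁ N) 𝒞) L k A𝒫e C₂e 𝒞e)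
    {κp : ℝ} (hκp : 0 ≤ κp) {ℓnf : Finset (Fin d → ZMod M) → ℝ} {ℓbar lamR : ℝ}
    (hℓn0 : ∀ U : Finset (Fin d → ZMod M), 0 ≤ ℓnf U)
    (hℓn : ∀ U : Finset (Fin d → ZMod M), ℓnf U * lamR ^ (blocks (L * L ^ k) U).card ≤ ℓbar)
    (hlam0 : 0 < lamR) (hlam1 : lamR ≤ 1)
    (hdiffU : ∀ U : Finset (Fin d → ZMod M), IsPolymer (L ^ (k + 1)) U → IsConn U →
      ∀ X : Finset (Fin d → ZMod M), IsPolymer (L ^ k) X → X ⊆ thicken ((2 ^ d - 1) * L ^ k) U →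
      ∀ (F : ((Fin d → ZMod M) → ℝ) → ℂ) (b : ℝ), 0 ≤ b → ContDiff ℝ r₀ F →
        IsGaugeLocal ((abkmNormParams L N Mord R p r₀ h θbar A (schedDelta δ₀ δ₁ N) 𝒞).gauge k X) F →
        TayNormLE ((abkmNormParams L N Mord R p r₀ h θbar A (schedDelta δ₀ δ₁ N) 𝒞).gauge k X) r₀
          ((abkmWeightData L N Mord R θbar (schedDelta δ₀ δ₁ N) 𝒞).weight k X) F b →
          TayNormLE ((abkmNormParams L N Mord R p r₀ h θbar A (schedDelta δ₀ δ₁ N) 𝒞).gauge k X) r₀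
            ((abkmWeightData L N Mord R θbar (schedDelta δ₀ δ₁ N) 𝒞).midWeight k X)
            (fluct 𝒞a F - fluct 𝒞b F - fluct 𝒞c F + fluct 𝒞e F) (b * ℓnf U * κp ^ numBlocks (L ^ k) X))
    {H : RelevantHamiltonian ℂ d} {b : ℝ}
    (hH : hamNorm (fieldWt h (L : ℝ) d k) ((L : ℝ) ^ k) (L ^ (d * k)) H ≤ b) (hb : b ≤ 1 / 64)
    {K : Finset (Fin d → ZMod M) → ((Fin d → ZMod M) → ℝ) → ℂ} {C : ℝ} (hC : 0 ≤ C)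
    (hK : WeakNormLE (abkmNormParams L N Mord R p r₀ h θbar A (schedDelta δ₀ δ₁ N) 𝒞) k K C)
    (hKfac : Factorises (L ^ k) K) (hK0 : ∀ φ, K ∅ φ = 1) (hKd : ∀ Y, ContDiff ℝ r₀ (K Y))
    (hKloc : ∀ Y, IsPolymer (L ^ k) Y → IsConn Y →
      IsGaugeLocal ((abkmNormParams L N Mord R p r₀ h θbar A (schedDelta δ₀ δ₁ N) 𝒞).gauge k Y) (K Y))
    {τ : ℝ} (hτ : τ ≤ 1 / 16)
    {Ht : RelevantHamiltonian ℂ d} (hHt : hamNorm (fieldWt h (L : ℝ) d k) ((L : ℝ) ^ k) (L ^ (d * k)) Ht ≤ τ)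
    {ω κ : ℝ}
    (hω1 : 8 * Real.exp (1 / 4) * τ ≤ ω)
    (hω2 : 8 * Real.exp (1 / 4) * b + 8 * Real.exp (1 / 4) * b ≤ ω)
    (hω3 : C + C ≤ ω) (hωA : ω * A ^ 2 ≤ 1)
    (hκ : 1 + Real.exp (1 / 4) ≤ κ)
    (hc3b : κ ^ (L ^ d) * ((2 * (2 * κ * max 1 (max A𝒫a κp))) ^ ((2 ^ (d + 1) + 2) ^ d * L ^ d) * (4 : ℝ) ^ ((2 ^ (d + 1) + 2) ^ d * L ^ d)) ≤ lamR * A ^ ((1 + 1 / ((2 * (2 ^ d + 1) + 6 : ℝ) ^ d)) - 1 : ℝ))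
    (hc2b : κ ^ (L ^ d) * ((2 * κ * max 1 (max A𝒫a κp)) ^ ((2 ^ (d + 1) + 2) ^ d * L ^ d) * (2 : ℝ) ^ ((2 ^ (d + 1) + 2) ^ d * L ^ d)) ≤ lamR * A ^ ((1 + 1 / ((2 * (2 ^ d + 1) + 6 : ℝ) ^ d)) - 1 : ℝ)) :
    WeakNormLE (abkmNormParams L N Mord R p r₀ h θbar A (schedDelta δ₀ δ₁ N) 𝒞) (k + 1)
      (fun U φ => nextK (L ^ k) (reblock (L ^ k) (L * L ^ k)) (stepMeasure 𝒞a) (expNegH H) (expNegH Ht) K U φ -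
        nextK (L ^ k) (reblock (L ^ k) (L * L ^ k)) (stepMeasure 𝒞b) (expNegH H) (expNegH Ht) K U φ -
        nextK (L ^ k) (reblock (L ^ k) (L * L ^ k)) (stepMeasure 𝒞c) (expNegH H) (expNegH Ht) K U φ +
        nextK (L ^ k) (reblock (L ^ k) (L * L ^ k)) (stepMeasure 𝒞e) (expNegH H) (expNegH Ht) K U φ)
      ((2 * ((L ^ d : ℕ) : ℝ) * (Real.exp (1 / 4) ^ (L ^ d) * Real.exp (1 / 4)) *
          ((8 * Real.exp (1 / 4) * hamNorm (fieldWt h (L : ℝ) d k) ((L : ℝ) ^ k) (L ^ (d * k)) H + C * A⁻¹) * (ℓbar * lamR⁻¹) * κp)) * A +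
        ℓbar * (((8 * Real.exp (1 / 4) * hamNorm (fieldWt h (L : ℝ) d k) ((L : ℝ) ^ k) (L ^ (d * k)) H + C) *
            (ω * A ^ 4)) + C) +
        ℓbar * ((8 * Real.exp (1 / 4) * hamNorm (fieldWt h (L : ℝ) d k) ((L : ℝ) ^ k) (L ^ (d * k)) H + C) *
            (ω * A ^ 4)) +
        ℓbar * ((8 * Real.exp (1 / 4) * hamNorm (fieldWt h (L : ℝ) d k) ((L : ℝ) ^ k) (L ^ (d * k)) H + C) *
            (ω * A ^ 4))) := by
  -- sizes and derived hypotheses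
  have hd2 : 2 ≤ d := by omega
  have hL0 : (0 : ℝ) < L := by exact_mod_cast hLodd.pos
  have hA0 : 0 < A := by linarith
  have h𝔥 : 0 < fieldWt h (L : ℝ) d k := fieldWt_pos hh hL0 d k
  have hRk : (0 : ℝ) < (L : ℝ) ^ k := by positivity
  have hnn : ∀ G : RelevantHamiltonian ℂ d, 0 ≤ hamNorm (fieldWt h (L : ℝ) d k) ((L : ℝ) ^ k) (L ^ (d * k)) G := fun G => hamNorm_nonneg h𝔥.le hRk.le _ _
  have hb0 : 0 ≤ b := (hnn H).trans hH
  have hH64 : hamNorm (fieldWt h (L : ℝ) d k) ((L : ℝ) ^ k) (L ^ (d * k)) H ≤ 1 / 64 := hH.trans hb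
  have hH16 : hamNorm (fieldWt h (L : ℝ) d k) ((L : ℝ) ^ k) (L ^ (d * k)) H ≤ 1 / 16 := hH64.trans (by norm_num)
  have hH8 : hamNorm (fieldWt h (L : ℝ) d k) ((L : ℝ) ^ k) (L ^ (d * k)) H ≤ 1 / 8 := hH64.trans (by norm_num)
  have hbbω : 8 * Real.exp (1 / 4) * hamNorm (fieldWt h (L : ℝ) d k) ((L : ℝ) ^ k) (L ^ (d * k)) H + 8 * Real.exp (1 / 4) * hamNorm (fieldWt h (L : ℝ) d k) ((L : ℝ) ^ k) (L ^ (d * k)) H ≤ ω := by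
    have : 8 * Real.exp (1 / 4) * hamNorm (fieldWt h (L : ℝ) d k) ((L : ℝ) ^ k) (L ^ (d * k)) H ≤ 8 * Real.exp (1 / 4) * b := mul_le_mul_of_nonneg_left hH (by positivity)
    linarith
  have hMo : Odd M := by rw [hM]; exact hLodd.pow
  have hsodd : Odd (L ^ k) := hLodd.pow
  intro U hU hUc
  have hUne : U.Nonempty := hUc.1
  have hℓnU := hℓn0 U
  -- the four pieces at `ℓ = ℓ_n(U)`
  have h1 := tayNormLE_singleBlock_kernelSecondDiff_abkm_blockFree (n := n) (lam := lam) (μ := μ) hd hLodd hL hR2 hM hkN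
    hSa hSb hSc hSe hp hMord hB hδ₀ hδ₁ hh hh0 hA𝒫a hA1 hU hHt hτ hH16 hC hK hKfac hK0 hKd hKloc hℓnU hκp (hdiffU U hU hUc)
  have h2 := tayNormLE_remainderTwoLarge_kernelSecondDiff_abkm (n := n) (lam := lam) (μ := μ) hd hLodd hL hR2 hM hkN hSa hSb
    hSc hSe hp hMord hB hδ₀ hδ₁ hh hh0 hA𝒫a hA1 hU hHt hτ hH16 hC hK hKfac hK0 hKd hKloc hℓnU hκp (hdiffU U hU hUc) hω1 hbbω
    hω3 hωA hκ
  have h3 := tayNormLE_remainderThree_kernelSecondDiff_abkm (n := n) (lam := lam) (μ := μ) hd hLodd hL hR2 hM hkN hSa hSb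
    hSc hSe hp hMord hB hδ₀ hδ₁ hh hh0 hA𝒫a hA1 hU hUne hHt hτ hH16 hC hK hKfac hK0 hKd hKloc hℓnU hκp (hdiffU U hU hUc) hω1
    hbbω hω3 hωA hκ
  have h4 := tayNormLE_remainderFour_kernelSecondDiff_abkm (n := n) (lam := lam) (μ := μ) hd hLodd hL hR2 hM hkN hSa hSb
    hSc hSe hp hMord hB hδ₀ hδ₁ hh hh0 hA𝒫a hA1 hU hHt hτ hH16 hC hK hKfac hK0 hKd hKloc hℓnU hκp (hdiffU U hU hUc) hω1 hbbω
    hω3 hωA hκ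
  -- block counts: `|U|_k = L^d |U|_{k+1}`, `|U|_{k+1} ≥ 1`, `aFactor = (A^u)⁻¹`
  have hMeq : M = L * L ^ k * L ^ (N - k - 1) := by
    rw [hM, ← pow_succ', ← pow_add]; congr 1; omega
  have hUm : IsPolymer (L * L ^ k) U := by rw [← pow_succ']; exact hU
  have hm0 : (blocks (L ^ k) U).card = L ^ d * (blocks (L * L ^ k) U).card :=
    TorusPolymer.card_blocks_eq_mul hMeq hsodd hLodd hLodd.pow hUm
  have hm1 : 1 ≤ (blocks (L * L ^ k) U).card := by
    obtain ⟨u, hu⟩ := hUc.1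
    exact card_pos.2 ⟨blockOf (L * L ^ k) u, mem_blocks.2 ⟨u, hu, rfl⟩⟩
  have haF : (abkmNormParams L N Mord R p r₀ h θbar A (schedDelta δ₀ δ₁ N) 𝒞).aFactor (k + 1) U =
      (A ^ (blocks (L * L ^ k) U).card)⁻¹ := by
    show (A ^ numBlocks (L ^ (k + 1)) U)⁻¹ = _
    rw [← card_blocks_eq_numBlocks, pow_succ']
  -- the block term with `ℓ_n(U) ≤ ℓ̄ λ⁻¹` on single blocks (and zero otherwise)
  have hℓbar0 : 0 ≤ ℓbar := le_trans (mul_nonneg (hℓn0 ∅) (pow_nonneg hlam0.le _)) (hℓn ∅)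
  have h1' : TayNormLE ((abkmNormParams L N Mord R p r₀ h θbar A (schedDelta δ₀ δ₁ N) 𝒞).gauge (k + 1) U) r₀
      ((abkmWeightData L N Mord R θbar (schedDelta δ₀ δ₁ N) 𝒞).weight (k + 1) U)
      (fun φ => ∑ X ∈ (blocks (L ^ k) univ).filter (fun B => TorusPolymer.closure (L * L ^ k) B = U),
        ∑ X₁ ∈ ({∅, X} : Finset (Finset (Fin d → ZMod M))),
        (bprod (L ^ k) (fun B => expNegH Ht B φ) (U \ X) * bprod (L ^ k) (fun B => expNegH (-Ht) B φ) (X \ U) *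
            (bprod (L ^ k) (fun B => 1 - expNegH Ht B φ) X₁ * fluct 𝒞a (polyP2 (L ^ k) H K (X \ X₁)) φ) -
          bprod (L ^ k) (fun B => expNegH Ht B φ) (U \ X) * bprod (L ^ k) (fun B => expNegH (-Ht) B φ) (X \ U) *
            (bprod (L ^ k) (fun B => 1 - expNegH Ht B φ) X₁ * fluct 𝒞b (polyP2 (L ^ k) H K (X \ X₁)) φ) -
          bprod (L ^ k) (fun B => expNegH Ht B φ) (U \ X) * bprod (L ^ k) (fun B => expNegH (-Ht) B φ) (X \ U) *
            (bprod (L ^ k) (fun B => 1 - expNegH Ht B φ) X₁ * fluct 𝒞c (polyP2 (L ^ k) H K (X \ X₁)) φ) +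
          bprod (L ^ k) (fun B => expNegH Ht B φ) (U \ X) * bprod (L ^ k) (fun B => expNegH (-Ht) B φ) (X \ U) *
            (bprod (L ^ k) (fun B => 1 - expNegH Ht B φ) X₁ * fluct 𝒞e (polyP2 (L ^ k) H K (X \ X₁)) φ)))
      (2 * ((L ^ d : ℕ) : ℝ) * (Real.exp (1 / 4) ^ (L ^ d) * Real.exp (1 / 4)) *
        ((8 * Real.exp (1 / 4) * hamNorm (fieldWt h (L : ℝ) d k) ((L : ℝ) ^ k) (L ^ (d * k)) H + C * A⁻¹) * (ℓbar * lamR⁻¹) * κp) *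
        (A * (abkmNormParams L N Mord R p r₀ h θbar A (schedDelta δ₀ δ₁ N) 𝒞).aFactor (k + 1) U)) := by
    by_cases hone : (blocks (L * L ^ k) U).card = 1
    · have hℓle : ℓnf U ≤ ℓbar * lamR⁻¹ := by
        have h := hℓn U
        rw [hone, pow_one] at h
        rw [le_mul_inv_iff₀ hlam0]
        exact h
      refine h1.mono ?_ fun φ => ((abkmWeightData L N Mord R θbar (schedDelta δ₀ δ₁ N) 𝒞).weight_pos (k + 1) U φ).le
      have haF0 : 0 ≤ A * (abkmNormParams L N Mord R p r₀ h θbar A (schedDelta δ₀ δ₁ N) 𝒞).aFactor (k + 1) U :=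
        mul_nonneg hA0.le (WeakNormLE.aFactor_pos hA0 (k + 1) U).le
      have hcH0 : 0 ≤ 8 * Real.exp (1 / 4) * hamNorm (fieldWt h (L : ℝ) d k) ((L : ℝ) ^ k) (L ^ (d * k)) H + C * A⁻¹ := by have := hnn H; positivity
      have hin : (8 * Real.exp (1 / 4) * hamNorm (fieldWt h (L : ℝ) d k) ((L : ℝ) ^ k) (L ^ (d * k)) H + C * A⁻¹) * ℓnf U * κp ≤ (8 * Real.exp (1 / 4) * hamNorm (fieldWt h (L : ℝ) d k) ((L : ℝ) ^ k) (L ^ (d * k)) H + C * A⁻¹) * (ℓbar * lamR⁻¹) * κp :=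
        mul_le_mul_of_nonneg_right (mul_le_mul_of_nonneg_left hℓle hcH0) hκp
      exact mul_le_mul_of_nonneg_right (mul_le_mul_of_nonneg_left hin (by positivity)) haF0
    · -- not a single block: the block family is empty and the function vanishes
      have hT₁ : (blocks (L ^ k) univ).filter (fun B => TorusPolymer.closure (L * L ^ k) B = U) = ∅ := by
        rw [filter_eq_empty_iff]
        intro B hB hcl
        obtain ⟨x, -, rfl⟩ := mem_blocks.1 hB
        rw [closure_blockOf_mul hsodd hLodd x] at hcl
        apply hone
        rw [← hcl, blocks_blockOf, card_singleton]
      intro φ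
      rw [hT₁]
      simp only [sum_empty]
      rw [tayNorm_const, norm_zero]
      have haF0 : 0 ≤ (abkmNormParams L N Mord R p r₀ h θbar A (schedDelta δ₀ δ₁ N) 𝒞).aFactor (k + 1) U :=
        (WeakNormLE.aFactor_pos hA0 (k + 1) U).le
      have hw0 := ((abkmWeightData L N Mord R θbar (schedDelta δ₀ δ₁ N) 𝒞).weight_pos (k + 1) U φ).le
      have := hnn H
      positivity
  have hglue := tayNormLE_nextK_freeHt_kernelSecondDiff_of_pieces (n := n) (lam := lam) (μ := μ) hd2 hLodd hM hkN hp hMord hB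
    hδ₀ hδ₁ hh hh0 hA0 hSa hSb hSc hSe hH8 Ht hC hK hKfac hK0 hKd hKloc hUne h1' h2 h3 h4
  refine hglue.mono ?_ fun φ => ((abkmWeightData L N Mord R θbar (schedDelta δ₀ δ₁ N) 𝒞).weight_pos (k + 1) U φ).le
  rw [haF]
  -- nonnegativity of the letters
  have hnH := hnn H
  have hω0 : 0 ≤ ω := le_trans (by positivity) hω3
  have hκ0 : 0 ≤ κ := by linarith [hκ, Real.exp_pos (1 / 4)]
  have hE2b0 : 0 ≤ ((8 * Real.exp (1 / 4) * hamNorm (fieldWt h (L : ℝ) d k) ((L : ℝ) ^ k) (L ^ (d * k)) H + C) *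
            (ω * A ^ 4)) := by positivity
  have hX3b0 : 0 ≤ κ ^ (L ^ d) * ((2 * (2 * κ * max 1 (max A𝒫a κp))) ^ ((2 ^ (d + 1) + 2) ^ d * L ^ d) * (4 : ℝ) ^ ((2 ^ (d + 1) + 2) ^ d * L ^ d)) := by positivity
  have hX2b0 : 0 ≤ κ ^ (L ^ d) * ((2 * κ * max 1 (max A𝒫a κp)) ^ ((2 ^ (d + 1) + 2) ^ d * L ^ d) * (2 : ℝ) ^ ((2 ^ (d + 1) + 2) ^ d * L ^ d)) := by positivity
  have hApow : 0 ≤ A ^ ((1 + 1 / ((2 * (2 ^ d + 1) + 6 : ℝ) ^ d)) - 1 : ℝ) := Real.rpow_nonneg hA0.le _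
  have hAu0 : 0 ≤ (A ^ (blocks (L * L ^ k) U).card)⁻¹ := by positivity
  -- the gains (with room)
  have g3b : κ ^ (blocks (L ^ k) U).card * (((2 * (2 * κ * max 1 (max A𝒫a κp))) ^ ((2 ^ (d + 1) + 2) ^ d * L ^ d) * (4 : ℝ) ^ ((2 ^ (d + 1) + 2) ^ d * L ^ d)) ^ (blocks (L * L ^ k) U).card * A ^ (-((1 + 1 / ((2 * (2 ^ d + 1) + 6 : ℝ) ^ d)) * (blocks (L * L ^ k) U).card) : ℝ)) ≤ lamR ^ (blocks (L * L ^ k) U).card * (A ^ (blocks (L * L ^ k) U).card)⁻¹ := by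
    rw [hm0, pow_mul, ← mul_assoc, ← mul_pow]
    exact pow_mul_rpow_le_geom_inv_pow (N0 := 1) hA1 hX3b0 hApow hlam0.le hlam1 le_rfl (by rw [pow_one]; exact hc3b) le_rfl hm1
  have g2b : κ ^ (blocks (L ^ k) U).card * (((2 * κ * max 1 (max A𝒫a κp)) ^ ((2 ^ (d + 1) + 2) ^ d * L ^ d) * (2 : ℝ) ^ ((2 ^ (d + 1) + 2) ^ d * L ^ d)) ^ (blocks (L * L ^ k) U).card * A ^ (-((1 + 1 / ((2 * (2 ^ d + 1) + 6 : ℝ) ^ d)) * (blocks (L * L ^ k) U).card) : ℝ)) ≤ lamR ^ (blocks (L * L ^ k) U).card * (A ^ (blocks (L * L ^ k) U).card)⁻¹ := by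
    rw [hm0, pow_mul, ← mul_assoc, ← mul_pow]
    exact pow_mul_rpow_le_geom_inv_pow (N0 := 1) hA1 hX2b0 hApow hlam0.le hlam1 le_rfl (by rw [pow_one]; exact hc2b) le_rfl hm1
  have hℓlam : ℓnf U * lamR ^ (blocks (L * L ^ k) U).card ≤ ℓbar := hℓn U
  have hlamu0 : 0 ≤ lamR ^ (blocks (L * L ^ k) U).card := pow_nonneg hlam0.le _
  -- termwise bounds (verbatim the kernel-only half of the first-order weak conversion)
  have e3b : ∀ (E : ℝ), 0 ≤ E → ℓnf U * (κ ^ (blocks (L ^ k) U).card * E * (((2 * (2 * κ * max 1 (max A𝒫a κp))) ^ ((2 ^ (d + 1) + 2) ^ d * L ^ d) * (4 : ℝ) ^ ((2 ^ (d + 1) + 2) ^ d * L ^ d)) ^ (blocks (L * L ^ k) U).card * A ^ (-((1 + 1 / ((2 * (2 ^ d + 1) + 6 : ℝ) ^ d)) * (blocks (L * L ^ k) U).card) : ℝ))) ≤ ℓbar * E * (A ^ (blocks (L * L ^ k) U).card)⁻¹ := by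
    intro E hE
    have h1 : κ ^ (blocks (L ^ k) U).card * E * (((2 * (2 * κ * max 1 (max A𝒫a κp))) ^ ((2 ^ (d + 1) + 2) ^ d * L ^ d) * (4 : ℝ) ^ ((2 ^ (d + 1) + 2) ^ d * L ^ d)) ^ (blocks (L * L ^ k) U).card * A ^ (-((1 + 1 / ((2 * (2 ^ d + 1) + 6 : ℝ) ^ d)) * (blocks (L * L ^ k) U).card) : ℝ)) ≤ E * (lamR ^ (blocks (L * L ^ k) U).card * (A ^ (blocks (L * L ^ k) U).card)⁻¹) := by
      calc κ ^ (blocks (L ^ k) U).card * E * (((2 * (2 * κ * max 1 (max A𝒫a κp))) ^ ((2 ^ (d + 1) + 2) ^ d * L ^ d) * (4 : ℝ) ^ ((2 ^ (d + 1) + 2) ^ d * L ^ d)) ^ (blocks (L * L ^ k) U).card * A ^ (-((1 + 1 / ((2 * (2 ^ d + 1) + 6 : ℝ) ^ d)) * (blocks (L * L ^ k) U).card) : ℝ)) = E * (κ ^ (blocks (L ^ k) U).card * (((2 * (2 * κ * max 1 (max A𝒫a κp))) ^ ((2 ^ (d + 1) + 2) ^ d * L ^ d) * (4 : ℝ) ^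 ((2 ^ (d + 1) + 2) ^ d * L ^ d)) ^ (blocks (L * L ^ k) U).card * A ^ (-((1 + 1 / ((2 * (2 ^ d + 1) + 6 : ℝ) ^ d)) * (blocks (L * L ^ k) U).card) : ℝ))) := by ring
        _ ≤ E * (lamR ^ (blocks (L * L ^ k) U).card * (A ^ (blocks (L * L ^ k) U).card)⁻¹) := mul_le_mul_of_nonneg_left g3b hE
    have h2 := mul_le_mul_of_nonneg_left h1 hℓnU
    have h3 : ℓnf U * (E * (lamR ^ (blocks (L * L ^ k) U).card * (A ^ (blocks (L * L ^ k) U).card)⁻¹)) = (ℓnf U * lamR ^ (blocks (L * L ^ k) U).card) * (E * (A ^ (blocks (L * L ^ k) U).card)⁻¹) := by ring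
    have h4 : (ℓnf U * lamR ^ (blocks (L * L ^ k) U).card) * (E * (A ^ (blocks (L * L ^ k) U).card)⁻¹) ≤ ℓbar * (E * (A ^ (blocks (L * L ^ k) U).card)⁻¹) :=
      mul_le_mul_of_nonneg_right hℓlam (mul_nonneg hE hAu0)
    calc _ ≤ ℓnf U * (E * (lamR ^ (blocks (L * L ^ k) U).card * (A ^ (blocks (L * L ^ k) U).card)⁻¹)) := h2
      _ = (ℓnf U * lamR ^ (blocks (L * L ^ k) U).card) * (E * (A ^ (blocks (L * L ^ k) U).card)⁻¹) := h3
      _ ≤ ℓbar * (E * (A ^ (blocks (L * L ^ k) U).card)⁻¹) := h4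
      _ = ℓbar * E * (A ^ (blocks (L * L ^ k) U).card)⁻¹ := by ring
  have e2bb : ℓnf U * (κ ^ (blocks (L ^ k) U).card * ((8 * Real.exp (1 / 4) * hamNorm (fieldWt h (L : ℝ) d k) ((L : ℝ) ^ k) (L ^ (d * k)) H + C) *
            (ω * A ^ 4)) * (((2 * (2 * κ * max 1 (max A𝒫a κp))) ^ ((2 ^ (d + 1) + 2) ^ d * L ^ d) * (4 : ℝ) ^ ((2 ^ (d + 1) + 2) ^ d * L ^ d)) ^ (blocks (L * L ^ k) U).card * A ^ (-((1 + 1 / ((2 * (2 ^ d + 1) + 6 : ℝ) ^ d)) * (blocks (L * L ^ k) U).card) : ℝ)) + κ ^ (blocks (L ^ k) U).card * C * (((2 * κ * max 1 (max A𝒫a κp)) ^ ((2 ^ (d + 1) + 2) ^ d * L ^ d) * (2 : ℝ) ^ ((2 ^ (d + 1) + 2) ^ d * L ^ d)) ^ (blocks (L * L ^ k) U).card * A ^ (-((1 + 1 / ((2 * (2 ^ d + 1) + 6 : ℝ) ^ d)) * (blocks (L * L ^ k) U).card) : ℝ))) ≤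
      ℓbar * (((8 * Real.exp (1 / 4) * hamNorm (fieldWt h (L : ℝ) d k) ((L : ℝ) ^ k) (L ^ (d * k)) H + C) *
            (ω * A ^ 4)) + C) * (A ^ (blocks (L * L ^ k) U).card)⁻¹ := by
    have h1 : κ ^ (blocks (L ^ k) U).card * ((8 * Real.exp (1 / 4) * hamNorm (fieldWt h (L : ℝ) d k) ((L : ℝ) ^ k) (L ^ (d * k)) H + C) *
            (ω * A ^ 4)) * (((2 * (2 * κ * max 1 (max A𝒫a κp))) ^ ((2 ^ (d + 1) + 2) ^ d * L ^ d) * (4 : ℝ) ^ ((2 ^ (d + 1) + 2) ^ d * L ^ d)) ^ (blocks (L * L ^ k) U).card * A ^ (-((1 + 1 / ((2 * (2 ^ d + 1) + 6 : ℝ) ^ d)) * (blocks (L * L ^ k) U).card) : ℝ)) ≤ ((8 * Real.exp (1 / 4) * hamNorm (fieldWt h (L : ℝ) d k) ((L : ℝ) ^ k) (L ^ (d * k)) H + C) *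
            (ω * A ^ 4)) * (lamR ^ (blocks (L * L ^ k) U).card * (A ^ (blocks (L * L ^ k) U).card)⁻¹) := by
      calc κ ^ (blocks (L ^ k) U).card * ((8 * Real.exp (1 / 4) * hamNorm (fieldWt h (L : ℝ) d k) ((L : ℝ) ^ k) (L ^ (d * k)) H + C) *
            (ω * A ^ 4)) * (((2 * (2 * κ * max 1 (max A𝒫a κp))) ^ ((2 ^ (d + 1) + 2) ^ d * L ^ d) * (4 : ℝ) ^ ((2 ^ (d + 1) + 2) ^ d * L ^ d)) ^ (blocks (L * L ^ k) U).card * A ^ (-((1 + 1 / ((2 * (2 ^ d + 1) + 6 : ℝ) ^ d)) * (blocks (L * L ^ k) U).card) : ℝ)) = ((8 * Real.exp (1 / 4) * hamNorm (fieldWt h (L : ℝ) d k) ((L : ℝ) ^ k) (L ^ (d * k)) H + C) *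
            (ω * A ^ 4)) * (κ ^ (blocks (L ^ k) U).card * (((2 * (2 * κ * max 1 (max A𝒫a κp))) ^ ((2 ^ (d + 1) + 2) ^ d * L ^ d) * (4 : ℝ) ^ ((2 ^ (d + 1) + 2) ^ d * L ^ d)) ^ (blocks (L * L ^ k) U).card * A ^ (-((1 + 1 / ((2 * (2 ^ d + 1) + 6 : ℝ) ^ d)) * (blocks (L * L ^ k) U).card) : ℝ))) := by ring
        _ ≤ ((8 * Real.exp (1 / 4) * hamNorm (fieldWt h (L : ℝ) d k) ((L : ℝ) ^ k) (L ^ (d * k)) H + C) *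
            (ω * A ^ 4)) * (lamR ^ (blocks (L * L ^ k) U).card * (A ^ (blocks (L * L ^ k) U).card)⁻¹) := mul_le_mul_of_nonneg_left g3b hE2b0
    have h1' : κ ^ (blocks (L ^ k) U).card * C * (((2 * κ * max 1 (max A𝒫a κp)) ^ ((2 ^ (d + 1) + 2) ^ d * L ^ d) * (2 : ℝ) ^ ((2 ^ (d + 1) + 2) ^ d * L ^ d)) ^ (blocks (L * L ^ k) U).card * A ^ (-((1 + 1 / ((2 * (2 ^ d + 1) + 6 : ℝ) ^ d)) * (blocks (L * L ^ k) U).card) : ℝ)) ≤ C * (lamR ^ (blocks (L * L ^ k) U).card * (A ^ (blocks (L * L ^ k) U).card)⁻¹) := by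
      calc κ ^ (blocks (L ^ k) U).card * C * (((2 * κ * max 1 (max A𝒫a κp)) ^ ((2 ^ (d + 1) + 2) ^ d * L ^ d) * (2 : ℝ) ^ ((2 ^ (d + 1) + 2) ^ d * L ^ d)) ^ (blocks (L * L ^ k) U).card * A ^ (-((1 + 1 / ((2 * (2 ^ d + 1) + 6 : ℝ) ^ d)) * (blocks (L * L ^ k) U).card) : ℝ)) = C * (κ ^ (blocks (L ^ k) U).card * (((2 * κ * max 1 (max A𝒫a κp)) ^ ((2 ^ (d + 1) + 2) ^ d * L ^ d) * (2 : ℝ) ^ ((2 ^ (d + 1) + 2) ^ d * L ^ d)) ^ (blocks (L * L ^ k) U).card * A ^ (-((1 + 1 / ((2 * (2 ^ d + 1) + 6 : ℝ) ^ d)) * (blocks (L * L ^ k) U).card) : ℝ))) := by ring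
        _ ≤ C * (lamR ^ (blocks (L * L ^ k) U).card * (A ^ (blocks (L * L ^ k) U).card)⁻¹) := mul_le_mul_of_nonneg_left g2b hC
    have h2 := mul_le_mul_of_nonneg_left (add_le_add h1 h1') hℓnU
    have h3 : ℓnf U * (((8 * Real.exp (1 / 4) * hamNorm (fieldWt h (L : ℝ) d k) ((L : ℝ) ^ k) (L ^ (d * k)) H + C) *
            (ω * A ^ 4)) * (lamR ^ (blocks (L * L ^ k) U).card * (A ^ (blocks (L * L ^ k) U).card)⁻¹) + C * (lamR ^ (blocks (L * L ^ k) U).card * (A ^ (blocks (L * L ^ k) U).card)⁻¹)) =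
        (ℓnf U * lamR ^ (blocks (L * L ^ k) U).card) * ((((8 * Real.exp (1 / 4) * hamNorm (fieldWt h (L : ℝ) d k) ((L : ℝ) ^ k) (L ^ (d * k)) H + C) *
            (ω * A ^ 4)) + C) * (A ^ (blocks (L * L ^ k) U).card)⁻¹) := by ring
    have h4 : (ℓnf U * lamR ^ (blocks (L * L ^ k) U).card) * ((((8 * Real.exp (1 / 4) * hamNorm (fieldWt h (L : ℝ) d k) ((L : ℝ) ^ k) (L ^ (d * k)) H + C) *
            (ω * A ^ 4)) + C) * (A ^ (blocks (L * L ^ k) U).card)⁻¹) ≤ ℓbar * ((((8 * Real.exp (1 / 4) * hamNorm (fieldWt h (L : ℝ) d k) ((L : ℝ) ^ k) (L ^ (d * k)) H + C) *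
            (ω * A ^ 4)) + C) * (A ^ (blocks (L * L ^ k) U).card)⁻¹) :=
      mul_le_mul_of_nonneg_right hℓlam (mul_nonneg (add_nonneg hE2b0 hC) hAu0)
    calc _ ≤ _ := h2
      _ = _ := h3
      _ ≤ _ := h4
      _ = ℓbar * (((8 * Real.exp (1 / 4) * hamNorm (fieldWt h (L : ℝ) d k) ((L : ℝ) ^ k) (L ^ (d * k)) H + C) *
            (ω * A ^ 4)) + C) * (A ^ (blocks (L * L ^ k) U).card)⁻¹ := by ring
  have t1 : 2 * ((L ^ d : ℕ) : ℝ) * (Real.exp (1 / 4) ^ (L ^ d) * Real.exp (1 / 4)) *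
        ((8 * Real.exp (1 / 4) * hamNorm (fieldWt h (L : ℝ) d k) ((L : ℝ) ^ k) (L ^ (d * k)) H + C * A⁻¹) * (ℓbar * lamR⁻¹) * κp) *
        (A * (A ^ (blocks (L * L ^ k) U).card)⁻¹) ≤ (2 * ((L ^ d : ℕ) : ℝ) * (Real.exp (1 / 4) ^ (L ^ d) * Real.exp (1 / 4)) *
        ((8 * Real.exp (1 / 4) * hamNorm (fieldWt h (L : ℝ) d k) ((L : ℝ) ^ k) (L ^ (d * k)) H + C * A⁻¹) * (ℓbar * lamR⁻¹) * κp)) * A * (A ^ (blocks (L * L ^ k) U).card)⁻¹ := le_of_eq (by ring)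
  have t3b := e3b _ hE2b0
  have t4b := e3b _ hE2b0
  refine (add_le_add (add_le_add (add_le_add t1 e2bb) t3b) t4b).trans (le_of_eq ?_)
  ring

end Literature.MathematicalPhysics.StatisticalMechanics.GradientRG

end
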